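import Summits.QuantumAdvantage.QuantumAdvantage.Theorems.NearExactIsExact.Negative.RankOneCore
import Summits.QuantumAdvantage.QuantumAdvantage.Theorems.NearExactIsExact.Negative.RankOneMoebius

/-!
# `NearExactIsExact` (stmt-QuantumAdvantage-14043) — THEOREM R1 (gen 38), part 4/4:
  rank-one transvection pencils over a twisted frame never realise the flat residual

**Context.** In the last Maiorana–McFarland habitat of `NearExactIsExact` (BQ-11, DISPROOF.md §46 of
the b2b cell) the normal form of a candidate biquadratic permutation is
`π(u,t) = (γ u, B(u) ⊕ M(u)·t)` over the `6`-bit frame `u`, with `γ` "twisted" (affine coordinates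
but one quadratic coordinate), `B` quadratic and `M(u)` an affine pencil of invertible matrices.
THEOREM TT (`Negative.TwistedTranslation`) kills `M` constant.  THEOREM R1 (this file) kills the
rank-one transvection pencils `M(u) = M₀(I + ℓ(u)E)`, `E² = 0`, `rk E = 1` — after a constant change
of block coordinates, `π(u,t) = (γ u, B(u) ⊕ t ⊕ ℓ(u)·t₁·e₀)` — for block length `r = 5`, ANY
non-constant Boolean `ℓ`, ANY quadratic `B`, ALL cubic `c₁, c₂`: `c₁ ⊕ c₂∘π ≠ 1_{u=0}`.

**Proof ("E-system", DISPROOF.md §46.9).** The `s`-Möbius coefficients `G_T(u)` of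
`s ↦ c₂(γu, B ⊕ s)` are the `t`-Möbius coefficients of `c₁ ∘ Φ`, `Φ(u,t) = (u, t ⊕ ℓ t₁ e₀)`
(`RankOneMoebius.moebius_pullback`): `G_T = (c₁)_T` whenever `1 ∉ T` or `0 ∈ T`, and
`G_{1ab} = (c₁)_{1ab} ⊕ ℓ·(c₁)_{0ab}`; so `C'_{0ab} = 0` (`a, b ≥ 2`, `C' = coefC c₂ ∘ γ`, using
that `ℓ` is not constant). The parity core (`RankOneCore.rankOne_core`: pair identity + expansions
of `B_m ĉ_m`) gives `1 = Σ_u c₂(γu, Bu) = [C'_{234}] · Σ_u B₂B₃B₄`, and the affine pair coefficients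
`G_{23}, G_{24}, G_{34}` put `B₄, B₃, B₂` in `span(B₁) + affine + affine∘γ`, whose triple products
have even weight (`RankOneToolkit.span_cubic_sum_zero`). Contradiction.

HONEST FRAMING: the value here is a THEOREM (a kernel-checked negative lemma closing one infinite
sub-family of the last Maiorana–McFarland habitat of `NearExactIsExact`), NOT summit progress; the crux
and the summit are untouched.
-/

set_option linter.dupNamespace false -- D-0017: single-problem summit ⇒ `QuantumAdvantage.QuantumAdvantage` by design

namespace Summit.QuantumAdvantage.QuantumAdvantage.Theorems.NearExactIsExact.Negative.RankOneTransvection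

open Finset
open Literature.Computability.QuantumComplexity
open Literature.Computability.QuantumComplexity.BuzetChailloux (bxor)
open Summit.QuantumAdvantage.QuantumAdvantage.Theorems.CubicForrelation.NearExactIsExact
  (fc_isDegLeFun_comp fc_deg_bxor te_isDegLeFun_band)
open Summit.QuantumAdvantage.QuantumAdvantage.Theorems.NearExactIsExact.Negative.SkewProductCore
open Summit.QuantumAdvantage.QuantumAdvantage.Theorems.NearExactIsExact.Negative.SkewProductResidual
open Summit.QuantumAdvantage.QuantumAdvantage.Theorems.NearExactIsExact.Negative.TwistedTranslation
open Summit.QuantumAdvantage.QuantumAdvantage.Theorems.NearExactIsExact.Negative.RankOneToolkit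
open Summit.QuantumAdvantage.QuantumAdvantage.Theorems.NearExactIsExact.Negative.RankOneCore
open Summit.QuantumAdvantage.QuantumAdvantage.Theorems.NearExactIsExact.Negative.RankOneMoebius

/-- **THEOREM R1 (gen 38).** See the module docstring; `ℓ` is only assumed non-constant
(`ℓ u₀ = 0`, `ℓ u₁ = 1`); `γ` has affine coordinates except coordinate `i₀` of degree `≤ 2`.
[folklore] -/
theorem rankOne_transvection_residual_ne_flat (γ : (Fin 6 → Bool) → (Fin 6 → Bool)) (i₀ : Fin 6)
    (hγa : ∀ i, i ≠ i₀ → IsDegLeFun 1 (fun u => γ u i)) (hγq : IsDegLeFun 2 (fun u => γ u i₀))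
    (B : Fin 5 → (Fin 6 → Bool) → Bool) (hB : ∀ k, IsDegLeFun 2 (B k))
    (ℓ : (Fin 6 → Bool) → Bool) (u₀ u₁ : Fin 6 → Bool) (hℓ₀ : ℓ u₀ = false) (hℓ₁ : ℓ u₁ = true)
    (c₁ c₂ : (Fin (6 + 5) → Bool) → Bool) (h₁ : IsDegLeFun 3 c₁) (h₂ : IsDegLeFun 3 c₂) :
    ¬ ∀ (u : Fin 6 → Bool) (w : Fin 5 → Bool),
      (c₁ (Fin.append u w) ^^
        c₂ (Fin.append (γ u) (fun k => (w k ^^ (decide (k = 0) && (ℓ u && w 1))) ^^ B k u))) =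
        decide (∀ i, u i = false) := by
  intro h
  have z2 : (2 : ZMod 2) = 0 := rfl
  -- the `s`-Möbius coefficients `G_T(u)` of `s ↦ c₂(γ u, B u ⊕ s)` and the relations (Q1)–(Q3)
  obtain ⟨G, hGdef⟩ : ∃ G : Finset (Fin 5) → (Fin 6 → Bool) → ZMod 2, ∀ T u, G T u =
      ∑ S ∈ (P3 5).filter (fun S => T ⊆ S),
        (∏ m ∈ S \ T, ind (B m u)) * ind (coefC c₂ S (γ u)) := ⟨fun T u => _, fun _ _ => rfl⟩
  obtain ⟨hQ1c, hQ2c, hQ3c⟩ := moebius_pullback γ B ℓ c₁ c₂ h₁ h₂ h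
  simp only [← hGdef] at hQ1c hQ2c hQ3c
  -- `G_T = C'_T` for `|T| = 3`; the constants `C'_T`, `(c₁)_T`, `|T| = 3`
  have hG3 : ∀ T : Finset (Fin 5), T.card = 3 → ∀ u, G T u = ind (coefC c₂ T (γ u)) := by
    intro T hT u
    rw [hGdef]
    have hs : (P3 5).filter (fun S => T ⊆ S) = {T} := by
      ext S
      simp only [mem_filter, mem_P3, mem_singleton]
      constructor
      · rintro ⟨hS3, hTS⟩
        exact (eq_of_subset_of_card_le hTS (by omega)).symm
      · rintro rfl
        exact ⟨by omega, Subset.rfl⟩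
    rw [hs, sum_singleton, Finset.sdiff_self, prod_empty, one_mul]
  have hconst₂ : ∀ T : Finset (Fin 5), T.card = 3 → ∀ v v', coefC c₂ T v = coefC c₂ T v' := by
    intro T hT v v'
    have h := coefC_deg c₂ h₂ T
    rw [hT] at h
    exact CubicForrelation.NearExactIsExact.tc_const_of_deg_zero h v v'
  have hconst₁ : ∀ T : Finset (Fin 5), T.card = 3 → ∀ v v', coefC c₁ T v = coefC c₁ T v' := by
    intro T hT v v'
    have h := coefC_deg c₁ h₁ T
    rw [hT] at h
    exact CubicForrelation.NearExactIsExact.tc_const_of_deg_zero h v v'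
  have hcard0 : ∀ a b : Fin 5, a ≠ 0 → b ≠ 0 → a ≠ b → ({0, a, b} : Finset (Fin 5)).card = 3 := by
    intro a b ha0 hb0 hab
    have h0ab : (0 : Fin 5) ∉ ({a, b} : Finset (Fin 5)) := by
      simp only [mem_insert, mem_singleton, not_or]; exact ⟨fun h => ha0 h.symm, fun h => hb0 h.symm⟩
    rw [card_insert_of_notMem h0ab, card_pair hab]
  have hcard1 : ∀ a b : Fin 5, a ≠ 1 → b ≠ 1 → a ≠ b → ({1, a, b} : Finset (Fin 5)).card = 3 := by
    intro a b ha1 hb1 hab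
    have h1ab : (1 : Fin 5) ∉ ({a, b} : Finset (Fin 5)) := by
      simp only [mem_insert, mem_singleton, not_or]; exact ⟨fun h => ha1 h.symm, fun h => hb1 h.symm⟩
    rw [card_insert_of_notMem h1ab, card_pair hab]
  -- (E3) `C'_{0ab} = 0` (`a, b ≥ 2`): `G_{1ab}` and `(c₁)_{1ab}` are constant but `ℓ` is not
  have hE3 : ∀ a b : Fin 5, a ≠ 0 → a ≠ 1 → b ≠ 0 → b ≠ 1 → a ≠ b → ∀ u,
      coefC c₂ {0, a, b} (γ u) = false := by
    intro a b ha0 ha1 hb0 hb1 hab u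
    have hc0 := hcard0 a b ha0 hb0 hab
    have hc1 := hcard1 a b ha1 hb1 hab
    have e0 : ∀ u, coefC c₂ {0, a, b} (γ u) = coefC c₁ {0, a, b} u := by
      intro u
      have h := hQ2c {0, a, b} (mem_insert_self _ _) u
      rw [hG3 _ hc0 u, decide_ind_eq_one] at h
      exact h
    have e1 : ∀ u, coefC c₂ {1, a, b} (γ u) = (coefC c₁ {1, a, b} u ^^ (ℓ u && coefC c₁ {0, a, b} u)) := by
      intro u
      have h := hQ3c a b ha0 ha1 hb0 hb1 hab u
      rw [hG3 _ hc1 u, decide_ind_eq_one] at h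
      exact h
    have f0 := e1 u₀
    rw [hℓ₀, Bool.false_and, Bool.xor_false] at f0
    have f1 := e1 u₁
    rw [hℓ₁, Bool.true_and] at f1
    rw [e0 u, hconst₁ _ hc0 u u₁]
    rw [hconst₂ _ hc1 (γ u₀) (γ u₁), hconst₁ _ hc1 u₀ u₁, f1] at f0
    revert f0
    generalize coefC c₁ {1, a, b} u₁ = p
    generalize coefC c₁ {0, a, b} u₁ = q
    cases p <;> cases q <;> simp
  -- degrees of the pulled-back coefficients and of the good pair coefficients
  have hC0 : IsDegLeFun 5 (fun u => coefC c₂ (∅ : Finset (Fin 5)) (γ u)) := by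
    have h := coefC_deg c₂ h₂ (∅ : Finset (Fin 5))
    rw [card_empty] at h
    exact (isDegLeFun_comp_twist (d := 2) h γ i₀ hγa hγq).mono (by norm_num)
  have hC1 : ∀ k : Fin 5, IsDegLeFun 3 (fun u => coefC c₂ {k} (γ u)) := fun k => by
    have h := coefC_deg c₂ h₂ ({k} : Finset (Fin 5))
    rw [card_singleton] at h
    exact isDegLeFun_comp_twist (d := 1) h γ i₀ hγa hγq
  have hD2 : ∀ T : Finset (Fin 5), T.card = 2 → IsDegLeFun 1 (coefC c₁ T) := by
    intro T hT2
    simpa [hT2] using coefC_deg c₁ h₁ T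
  have hgood : ∀ T : Finset (Fin 5), T.card = 2 → ((0 : Fin 5) ∈ T ∨ (1 : Fin 5) ∉ T) →
      IsDegLeFun 1 (fun u => decide (G T u = 1)) := by
    intro T hT2 hgt
    have hne : T.Nonempty := by rw [← card_pos, hT2]; norm_num
    have e : (fun u => decide (G T u = 1)) = coefC c₁ T := by
      funext u
      rcases hgt with h0 | h1
      · exact hQ2c T h0 u
      · exact hQ1c T h1 hne u
    rw [e]
    exact hD2 T hT2
  have hG1 : ∀ m : Fin 5, m ≠ 1 → IsDegLeFun 3 (fun u => decide (G {m} u = 1)) := by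
    intro m hm
    have e : (fun u => decide (G {m} u = 1)) = coefC c₁ {m} :=
      funext fun u => hQ1c {m} (notMem_singleton.mpr hm.symm) (singleton_nonempty m) u
    rw [e]
    have hd := coefC_deg c₁ h₁ ({m} : Finset (Fin 5))
    rw [card_singleton] at hd
    exact hd.mono (by norm_num)
  -- the parity core: `Σ_u c₂(γu, Bu) = [C'_{234}] Σ_u B₂B₃B₄`
  have hcore := rankOne_core (C := fun S u => coefC c₂ S (γ u)) hB hC0 hC1
    (fun m hm => by simpa only [hGdef] using hG1 m hm)
    (fun T hT2 hgt => by simpa only [hGdef] using hgood T hT2 hgt)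
    (fun a b ha0 ha1 hb0 hb1 hab u => hE3 a b ha0 ha1 hb0 hb1 hab u)
  have htexp1 : ∑ u, texp (fun S u => coefC c₂ S (γ u)) (fun m => B m u) u = 1 := by
    have h0 : ∀ u : Fin 6 → Bool,
        c₂ (Fin.append (γ u) (fun k => B k u)) = (c₁ (emb 5 u) ^^ decide (∀ i, u i = false)) := by
      intro u
      have h' := h u (fun _ => false)
      simp only [Bool.false_xor, Bool.and_false, Bool.xor_false] at h'
      exact bool_solve _ _ _ h'
    have hc₁ : ∑ u, ind (c₁ (emb 5 u)) = 0 :=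
      sum_ind_eq_zero_of_deg_five (fc_isDegLeFun_comp h₁ (emb 5) (emb_coord_deg 5) (by norm_num))
    have hδ : ∑ u : Fin 6 → Bool, ind (decide (∀ i, u i = false)) = 1 := by
      rw [Finset.sum_eq_single (fun _ => false)]
      · simp
      · intro u _ hu
        have hu' : ¬ ∀ i, u i = false := fun h' => hu (funext h')
        simp [hu']
      · intro h'
        exact absurd (mem_univ _) h'
    have hsum2 : ∑ u, ind (c₂ (Fin.append (γ u) (fun k => B k u))) = 1 := by
      simp_rw [h0, ind_xor]
      rw [sum_add_distrib, hc₁, hδ, zero_add]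
    rw [← hsum2]
    exact sum_congr rfl fun u _ => (expand_comp c₂ h₂ γ u _).symm
  have hmain : ∑ u, (∏ i ∈ ({2, 3, 4} : Finset (Fin 5)), ind (B i u)) *
      ind (coefC c₂ {2, 3, 4} (γ u)) = 1 := by
    rw [hcore] at htexp1
    simpa only using htexp1
  -- (STEP 4) `C'_{234}` is a constant; `0` is impossible outright ...
  have hk : ∀ (T : Finset (Fin 5)), T.card = 3 → ∀ u, coefC c₂ T (γ u) = coefC c₂ T (γ u₀) :=
    fun T hT u => hconst₂ T hT (γ u) (γ u₀)
  simp_rw [hk {2, 3, 4} (by decide)] at hmain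
  cases hκ : coefC c₂ {2, 3, 4} (γ u₀)
  · rw [hκ] at hmain
    simp at hmain
  -- ... and `1` puts `B₄, B₃, B₂` in the span class, whose triple products have even weight
  rw [hκ] at hmain
  simp only [ind_true, mul_one] at hmain
  rw [show (∑ u, ∏ i ∈ ({2, 3, 4} : Finset (Fin 5)), ind (B i u)) =
      ∑ u, ind (B 2 u) * (ind (B 3 u) * ind (B 4 u)) from
    sum_congr rfl fun u _ => by rw [prod_insert (by decide), prod_pair (by decide)]] at hmain
  have hGpair : ∀ a b e : Fin 5, (P3 5).filter (fun S => ({a, b} : Finset (Fin 5)) ⊆ S) =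
      {{a, b}, {0, a, b}, {1, a, b}, {e, a, b}} →
      ({a, b} : Finset (Fin 5)) \ {a, b} = ∅ → ({0, a, b} : Finset (Fin 5)) \ {a, b} = {0} →
      ({1, a, b} : Finset (Fin 5)) \ {a, b} = {1} → ({e, a, b} : Finset (Fin 5)) \ {a, b} = {e} →
      ({a, b} : Finset (Fin 5)) ∉ ({{0, a, b}, {1, a, b}, {e, a, b}} : Finset (Finset (Fin 5))) →
      ({0, a, b} : Finset (Fin 5)) ∉ ({{1, a, b}, {e, a, b}} : Finset (Finset (Fin 5))) →
      ({1, a, b} : Finset (Fin 5)) ≠ {e, a, b} →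
      ∀ u, G {a, b} u = ind (coefC c₂ {a, b} (γ u)) + ind (B 0 u) * ind (coefC c₂ {0, a, b} (γ u)) +
        ind (B 1 u) * ind (coefC c₂ {1, a, b} (γ u)) + ind (B e u) * ind (coefC c₂ {e, a, b} (γ u)) := by
    intro a b e hF h0 h1 h2 h3 n1 n2 n3 u
    rw [hGdef, hF, sum_insert n1, sum_insert n2, sum_pair n3, h0, h1, h2, h3, prod_empty,
      prod_singleton, prod_singleton, prod_singleton, one_mul]
    ring
  have hBspan : ∀ a b e : Fin 5, a ≠ 0 → a ≠ 1 → b ≠ 0 → b ≠ 1 → a ≠ b →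
      (∀ u, G {a, b} u = ind (coefC c₂ {a, b} (γ u)) + ind (B 0 u) * ind (coefC c₂ {0, a, b} (γ u)) +
        ind (B 1 u) * ind (coefC c₂ {1, a, b} (γ u)) + ind (B e u) * ind (coefC c₂ {e, a, b} (γ u))) →
      ({e, a, b} : Finset (Fin 5)) = {2, 3, 4} →
      ∀ u, ind (B e u) = ind (coefC c₁ {a, b} u ^^ coefC c₂ {a, b} (γ u)) +
        ind (B 1 u) * ind (coefC c₂ {1, a, b} (γ u₀)) := by
    intro a b e ha0 ha1 hb0 hb1 hab hG2 he u
    have h1ab : (1 : Fin 5) ∉ ({a, b} : Finset (Fin 5)) := by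
      simp only [mem_insert, mem_singleton, not_or]; exact ⟨fun h => ha1 h.symm, fun h => hb1 h.symm⟩
    have e := congrArg ind (hQ1c {a, b} h1ab ⟨a, mem_insert_self _ _⟩ u)
    rw [ind_decide_eq_one, hG2 u, hE3 a b ha0 ha1 hb0 hb1 hab u, he, hk {2, 3, 4} (by decide) u, hκ,
      hk {1, a, b} (hcard1 a b ha1 hb1 hab) u] at e
    rw [ind_xor]
    simp only [ind_false, ind_true, mul_zero, add_zero, mul_one] at e
    linear_combination e - (ind (coefC c₂ {a, b} (γ u)) +
      ind (B 1 u) * ind (coefC c₂ {1, a, b} (γ u₀))) * z2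
  have hB4 := hBspan 2 3 4 (by decide) (by decide) (by decide) (by decide) (by decide)
    (hGpair 2 3 4 (by decide) (by decide) (by decide) (by decide) (by decide) (by decide) (by decide)
      (by decide)) (by decide)
  have hB3 := hBspan 2 4 3 (by decide) (by decide) (by decide) (by decide) (by decide)
    (hGpair 2 4 3 (by decide) (by decide) (by decide) (by decide) (by decide) (by decide) (by decide)
      (by decide)) (by decide)
  have hB2 := hBspan 3 4 2 (by decide) (by decide) (by decide) (by decide) (by decide)
    (hGpair 3 4 2 (by decide) (by decide) (by decide) (by decide) (by decide) (by decide) (by decide)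
      (by decide)) (by decide)
  -- the span class: `Σ_u B₂B₃B₄ = 0`
  have hXa : ∀ a b : Fin 5, a ≠ b → IsDegLeFun 1 (coefC c₁ {a, b}) := fun a b hab =>
    hD2 {a, b} (card_pair hab)
  have hXf : ∀ a b : Fin 5, a ≠ b → IsDegLeFun 1 (coefC c₂ {a, b}) := fun a b hab => by
    simpa [card_pair hab] using coefC_deg c₂ h₂ {a, b}
  have hzero := span_cubic_sum_zero γ i₀ hγa hγq (hB 1) (hXa 3 4 (by decide)) (hXa 2 4 (by decide))
    (hXa 2 3 (by decide)) (hXf 3 4 (by decide)) (hXf 2 4 (by decide)) (hXf 2 3 (by decide)) _ _ _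
    hB2 hB3 hB4
  rw [hzero] at hmain
  exact zero_ne_one hmain

end Summit.QuantumAdvantage.QuantumAdvantage.Theorems.NearExactIsExact.Negative.RankOneTransvection
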